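import Summits.HodgeConjecture.HodgeConjecture.Theorems.Ring2AbelianAllAndreSpreadVerdier
import Summits.HodgeConjecture.HodgeConjecture.Theorems.Ring2AbelianAllAndreWeilPencilsNumerical
import Summits.HodgeConjecture.HodgeConjecture.Theorems.Ring2AbelianAllSpreadPerClass
import HarnessLib

/-!
# Ring 2 · sub-cell AbelianAll (ALL ABELIAN VARIETIES), André axis, part XX-b — the GRADED, PENCILWISE and
# `E`-POWER rows of parts XIX-a/b/c/e/f re-keyed from K[SpreadCurve] to K[Verdier]; POINT BY POINT on every compact
# abelian pencil, granted Verdier alone: LIFT AT `t` ⟺ TRANSPORT OUT OF `t` (no `HC_CM`, no CM point, no rationality);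
# and the referee's converse `F_CM ⟹ Num^CM` under `HC_CM` (REFEREE-AB F-ab-90)

HONEST FRAMING (page 1, verbatim): **research route, not a corollary; conditional on HC_CM plus one named
minimal statement.** Cell line: research route conditional on HC_CM; not a corollary; Q11.4-sentence-2 already
refuted in dim ≥ 3. Nothing in this file proves a case of the Hodge conjecture for an abelian variety. `HC_CM`
(`Theses.RankFourFaces.CMAbelianHodge`) and `HC_AV` (`Theses.PadicSemiregularLift.HodgeAbelianVarieties`) are
BINDERS wherever they occur; the reduction item `CMToAbelian` (stmt-HodgeConjecture-16267) is NOT closed here.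

## What this part does

Part XX-a proved the André axis's spreading input modulo `Motives.Verdier1976_genericLocalTriviality`
(`exists_algebraic_lift_of_forall_mem_algebraicClasses_of_verdier`: on a compact pencil of abelian varieties a global
class algebraic on EVERY fibre agrees on every fibre with ONE algebraic class of the total space — no rationality) and
re-keyed the node-level rows. This part re-keys the remaining K[SpreadCurve] rows and adds the pointwise dictionary:

* §1 **POINT BY POINT, granted Verdier only** (`forall_mem_algebraicClasses_iff_comap_le_sup_of_verdier`): at ANY
  point `t` of ANY compact pencil of abelian varieties, [every global class algebraic at `t` is algebraic on every
  fibre] ⟺ [the lift `(j_t^*)⁻¹ N^p(𝒳_t) ≤ N^p(𝒳) ⊔ ker j_t^*` in every codimension] — no `HC_CM`, no CM point, no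
  rationality or Hodge binder (part XIX-e had this only at CM points under `HC_CM`, part XIX-f at `E`-power points).
* §2 GRADED (parts XIX-a §4, XIX-b §3, XIX-c): `HCAtDim d ∧ Verdier ⟹` the lift, the lattice identity
  `(j_s^*)⁻¹N^p(𝒳_s) = N^p(𝒳) ⊔ ker j_s^*` and (Num_t) in every bidegree at every point of every compact pencil of
  abelian `d`-folds; `d = 4, 5` modulo Moonen–Zarhin 1999 + Markman 2025.
* §3 PENCILWISE at a CM point under `HC_CM` (part XIX-e): (Num_{f,t}) ⟺ (L_{f,t}) ⟺ (IHC_f) ⟺ (1.1)_f, K[HC_CM][Verdier].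
* §4 `E`-POWER points, no `HC_CM` (part XIX-f §4–§5): `NumE[d,p,q]` from `HCAtDim d`, from part IX's transport, and
  (Num_t) ⟺ (1.1)_f, K[Verdier].
* §5 `HC_CM ⊢ Num^CM ⟺ (4)` without Lemme 6.3.1 (part XIX-b §2), and **REFEREE-AB F-ab-90**: granted `HC_CM`,
  Lemme 6.3.1 and Verdier, `F_CM ⟺ Num^CM` (the sub-cell's least candidate `HodgeFailureSpreadsToCMFibre` and the
  numerical node agree under `HC_CM`; fact-free and modulo Lieberman alone only `Num^CM ⟹ F_CM` is known, part XII).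

EDGE LABELS for RING2-MAP: everything K[Verdier] (plus the displayed binders `HC_CM`, `h₂₁`, MZ99, Markman where they
occur). No `def`, no `sorry`, no new node; axioms standard.
References: Verdier1976; VoisinHodgeII2003 (§3.3.1, §10.2.1); CharlesSchnell2014Notes (11.3.5, 11.3.6, 11.3.11);
Kleiman1968AlgebraicCycles (§3); Abdulali1994FamiliesAV ((1.1), Lemma 6.2); Andre1996Motifs (§5.1, §6.3);
Milne2020HodgeClassesAV (Prop. 1); MoonenZarhin1999LowDim; Markman2025SecantWeil; vanGeemen1994HodgeAV (Thm. 4.3).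
-/

noncomputable section

set_option linter.dupNamespace false

namespace Summit.HodgeConjecture.HodgeConjecture.Ring2.AbelianAll

open CategoryTheory AlgebraicGeometry
open Literature.AlgebraicGeometry Literature.AlgebraicGeometry.Motives
open Literature.AlgebraicGeometry.HodgeTheory
open Literature.AlgebraicTopology.SingularHomology (cupProduct)
open Literature.AlgebraicGeometry.Abdulali1994 (InvariantCyclesHoldFor)
open Literature.AlgebraicGeometry.Andre1996 (andre1996_cmAnchoredPencil)
open Literature.AlgebraicGeometry.Deligne1982 (cmLocus)
open Summit.HodgeConjecture.HodgeConjecture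
open Summit.HodgeConjecture.HodgeConjecture.Theses
open Summit.HodgeConjecture.HodgeConjecture.Ring2.Deform (CompactAbelianPencilVHC)
open Summit.HodgeConjecture.HodgeConjecture.Ring2.Hypotheses (cmPowerLocus)
open Summit.HodgeConjecture.HodgeConjecture.Ring2.ClassTargets (HCAtDim hcAtDim_four_of_weilClassesFourfolds
  hcAtDim_five_of_hcAtDim_four)

variable {𝒳 S : SchemeOver ℂ}

/-- `NumE[d, p, q]` — part XIX-f's hypothesis shape ((Num_t)(p,q) at every `E`-power point). NOT a definition.
[cite: Kleiman1968AlgebraicCycles, §3 (D(X))] -/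
local notation3 (prettyPrint := false) "NumE[" d ", " p ", " q "]" =>
  ∀ ⦃𝒳 S : SchemeOver ℂ⦄ (f : 𝒳 ⟶ S) (hf : IsCompactAbelianPencil f d) (t : ComplexPoints S),
    t ∈ cmPowerLocus f d → ∀ (hpq : p + q = d), ∀ b ∈ algebraicClasses (fiberOver f t) q,
      (∀ a ∈ algebraicClasses 𝒳 p,
        cupProduct (two_mul_add_two_mul_succ_eq hpq) a (fiberGysin hf t q b) = 0) →
        fiberGysin hf t q b = 0

/-! ## §1 Point by point, granted Verdier only: lift at `t` ⟺ transport out of `t` -/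

/-- **POINT BY POINT, granted Verdier: TRANSPORT OUT OF `t` ⟺ LIFT AT `t`.** On a compact pencil `f : 𝒳 ⟶ S` of abelian
`d`-folds and at ANY complex point `t`: [for every `p`, every global class `W` with `j_t^* W` algebraic has `j_s^* W`
algebraic for every `s`] ⟺ [for every `p`, `(j_t^*)⁻¹ N^p(𝒳_t) ≤ N^p(𝒳) ⊔ ker j_t^*`]. (⟹: transport makes `W`
algebraic on every fibre and part XX-a's engine lifts it; ⟸: `W = η + κ`, `η` algebraic, `j_t^* κ = 0`, so
`j_s^* κ = 0` for all `s` by André's flatness (A4) — part XIX-f's `map_fiberι_mem_algebraicClasses_of_comap_le_sup`.)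
No `HC_CM`, no CM point, no rationality. [cite: Andre1996Motifs, §5.1 (A3)–(A4) (p. 25)]
[cite: VoisinHodgeII2003, §3.3.1 and §10.2.1 (proof of Thm. 10.19)] [cite: Verdier1976, Cor. (5.1)] -/
theorem forall_mem_algebraicClasses_iff_comap_le_sup_of_verdier (hGT : Verdier1976_genericLocalTriviality) {d : ℕ}
    {f : 𝒳 ⟶ S} (hf : IsCompactAbelianPencil f d) (t : ComplexPoints S) :
    (∀ (p : ℕ) (W : complexBetti 𝒳 (2 * p)),
      complexBetti.map (fiberι f t) (2 * p) W ∈ algebraicClasses (fiberOver f t) p →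
        ∀ s : ComplexPoints S, complexBetti.map (fiberι f s) (2 * p) W ∈ algebraicClasses (fiberOver f s) p) ↔
      ∀ p : ℕ, (algebraicClasses (fiberOver f t) p).comap (complexBetti.map (fiberι f t) (2 * p)).hom ≤
        algebraicClasses 𝒳 p ⊔ LinearMap.ker (complexBetti.map (fiberι f t) (2 * p)).hom := by
  constructor
  · intro h p W hW
    have hW' : complexBetti.map (fiberι f t) (2 * p) W ∈ algebraicClasses (fiberOver f t) p := hW
    obtain ⟨η, hη, hηW⟩ := exists_algebraic_lift_of_forall_mem_algebraicClasses_of_verdier hGT hf W (h p W hW')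
    change W ∈ algebraicClasses 𝒳 p ⊔ LinearMap.ker (complexBetti.map (fiberι f t) (2 * p)).hom
    rw [show W = η + (W - η) by abel]
    refine Submodule.add_mem_sup hη ?_
    rw [LinearMap.mem_ker, map_sub, sub_eq_zero]
    exact (hηW t).symm
  · intro h p W hW s
    exact map_fiberι_mem_algebraicClasses_of_comap_le_sup hf (h p) hW s

/-- **(IHC_f) ⟹ the lift at EVERY point, granted Verdier** (part XIX-e's `comap_le_sup_of_forall_mem_algebraicClasses`
re-keyed): a class `W` with `j_t^* W` algebraic lies in the `ℂ`-span of RATIONAL such classes (part XVII-b); a rational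
one has rational `(p,p)` fibre restrictions (part XVII-a), is algebraic on every fibre by (IHC_f), and is lifted by
part XX-a's engine. [cite: VoisinHodgeII2003, §3.3.1] [cite: CharlesSchnell2014Notes, Prop. 11.3.5] -/
theorem comap_le_sup_of_forall_mem_algebraicClasses_of_verdier (hGT : Verdier1976_genericLocalTriviality) {d : ℕ}
    {f : 𝒳 ⟶ S} (hf : IsCompactAbelianPencil f d)
    (h : ∀ (p : ℕ) (W : complexBetti 𝒳 (2 * p)),
      (∀ s : ComplexPoints S, IsRationalClass (complexBetti.map (fiberι f s) (2 * p) W) ∧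
        IsOfHodgeType d (fiberOver f s) (2 * p) p p (complexBetti.map (fiberι f s) (2 * p) W)) →
      ∀ s : ComplexPoints S, complexBetti.map (fiberι f s) (2 * p) W ∈ algebraicClasses (fiberOver f s) p)
    (p : ℕ) (t : ComplexPoints S) :
    (algebraicClasses (fiberOver f t) p).comap (complexBetti.map (fiberι f t) (2 * p)).hom ≤
      algebraicClasses 𝒳 p ⊔ LinearMap.ker (complexBetti.map (fiberι f t) (2 * p)).hom := by
  intro W hW
  have hW' : complexBetti.map (fiberι f t) (2 * p) W ∈ algebraicClasses (fiberOver f t) p := hW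
  have hspan := mem_span_rational_of_map_fiberι_mem_algebraicClasses hf hW'
  have hle : Submodule.span ℂ {W' : complexBetti 𝒳 (2 * p) | IsRationalClass W' ∧
      complexBetti.map (fiberι f t) (2 * p) W' ∈ algebraicClasses (fiberOver f t) p} ≤
      algebraicClasses 𝒳 p ⊔ LinearMap.ker (complexBetti.map (fiberι f t) (2 * p)).hom := by
    refine Submodule.span_le.2 ?_
    rintro W' ⟨hW'rat, hW'alg⟩
    have hbind := fibrewiseHodge_of_isRationalClass_of_mem_algebraicClasses hf hW'rat hW'alg
    obtain ⟨η, hη, hηW'⟩ := exists_algebraic_lift_of_forall_mem_algebraicClasses_of_verdier hGT hf W' (h p W' hbind)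
    change W' ∈ algebraicClasses 𝒳 p ⊔ LinearMap.ker (complexBetti.map (fiberι f t) (2 * p)).hom
    rw [show W' = η + (W' - η) by abel]
    refine Submodule.add_mem_sup hη ?_
    rw [LinearMap.mem_ker, map_sub, sub_eq_zero]
    exact (hηW' t).symm
  exact hle hspan

/-! ## §2 Graded: `HC` in dimension `d` alone, granted Verdier -/

/-- **`HCAtDim d` makes every global class with rational `(p,p)` fibre restrictions algebraic on every fibre of a
compact pencil of abelian `d`-folds** (each fibre is `≅ A'.X` with `dim A' = d`; move the class along the chart — the
inlined step of part XIX-a's `exists_algebraic_lift_of_hcAtDim`). No fact.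
[cite: CharlesSchnell2014Notes, Prop. 11.3.5 and Cor. 11.3.6 (p. 494)] -/
theorem forall_mem_algebraicClasses_of_hcAtDim {d : ℕ} (h : HCAtDim d) {f : 𝒳 ⟶ S}
    (hf : IsCompactAbelianPencil f d) {p : ℕ} (W : complexBetti 𝒳 (2 * p))
    (hW : ∀ s : ComplexPoints S, IsRationalClass (complexBetti.map (fiberι f s) (2 * p) W) ∧
      IsOfHodgeType d (fiberOver f s) (2 * p) p p (complexBetti.map (fiberι f s) (2 * p) W))
    (s : ComplexPoints S) : complexBetti.map (fiberι f s) (2 * p) W ∈ algebraicClasses (fiberOver f s) p := by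
  obtain ⟨B, hBdim, ⟨eB⟩⟩ := Andre1996.compactPencil_exists_abelianVariety_fiber_dim hf s
  have hB : IsSmoothProjective B.dim B.X := AbelianVariety.isSmoothProjective_holds
  have hHCB := ((hodgeConjectureFor_iff_of_isSmoothProjective nonempty_hodgeModel_holds hB).1 (h B hBdim)) p
  rw [hBdim] at hHCB
  exact (forall_hodgeClass_mem_algebraicClasses_iff_of_iso eB p).1 hHCB _ (hW s).1 (hW s).2

/-- **The engine under `HC` for the fibres, granted Verdier** (part XIX-a's `exists_algebraic_lift_of_hcAtDim`
re-keyed). [cite: CharlesSchnell2014Notes, Prop. 11.3.5 and Cor. 11.3.6 (p. 494)] [cite: Verdier1976, Cor. (5.1)] -/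
theorem exists_algebraic_lift_of_hcAtDim_of_verdier (hGT : Verdier1976_genericLocalTriviality) {d : ℕ}
    (h : HCAtDim d) {f : 𝒳 ⟶ S} (hf : IsCompactAbelianPencil f d) {p : ℕ} (W : complexBetti 𝒳 (2 * p))
    (hW : ∀ s : ComplexPoints S, IsRationalClass (complexBetti.map (fiberι f s) (2 * p) W) ∧
      IsOfHodgeType d (fiberOver f s) (2 * p) p p (complexBetti.map (fiberι f s) (2 * p) W)) :
    ∃ η ∈ algebraicClasses 𝒳 p, ∀ s : ComplexPoints S,
      complexBetti.map (fiberι f s) (2 * p) η = complexBetti.map (fiberι f s) (2 * p) W :=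
  exists_algebraic_lift_of_forall_mem_algebraicClasses_of_verdier hGT hf W
    (forall_mem_algebraicClasses_of_hcAtDim h hf W hW)

/-- **`HCAtDim d ∧ Verdier ⟹` the body of (L∀) at relative dimension `d`.** [cite: CharlesSchnell2014Notes, Cor. 11.3.6] -/
theorem algebraicFixedPart_body_of_hcAtDim_of_verdier (hGT : Verdier1976_genericLocalTriviality) {d : ℕ}
    (h : HCAtDim d) {f : 𝒳 ⟶ S} (hf : IsCompactAbelianPencil f d) (p : ℕ) (W : complexBetti 𝒳 (2 * p))
    (hW : ∀ s : ComplexPoints S, IsRationalClass (complexBetti.map (fiberι f s) (2 * p) W) ∧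
      IsOfHodgeType d (fiberOver f s) (2 * p) p p (complexBetti.map (fiberι f s) (2 * p) W))
    (s₀ : ComplexPoints S) :
    ∃ η ∈ algebraicClasses 𝒳 p,
      complexBetti.map (fiberι f s₀) (2 * p) η = complexBetti.map (fiberι f s₀) (2 * p) W := by
  obtain ⟨η, hη, hηW⟩ := exists_algebraic_lift_of_hcAtDim_of_verdier hGT h hf W hW
  exact ⟨η, hη, hηW s₀⟩

/-- **The lift at EVERY point from `HC` of the fibres, granted Verdier** (part XIX-c's `comap_le_sup_of_hcAtDim`
re-keyed). [cite: CharlesSchnell2014Notes, Cor. 11.3.6 (p. 494)] [cite: Verdier1976, Cor. (5.1)] -/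
theorem comap_le_sup_of_hcAtDim_of_verdier (hGT : Verdier1976_genericLocalTriviality) {d : ℕ} (h : HCAtDim d)
    {f : 𝒳 ⟶ S} (hf : IsCompactAbelianPencil f d) (p : ℕ) (t : ComplexPoints S) :
    (algebraicClasses (fiberOver f t) p).comap (complexBetti.map (fiberι f t) (2 * p)).hom ≤
      algebraicClasses 𝒳 p ⊔ LinearMap.ker (complexBetti.map (fiberι f t) (2 * p)).hom :=
  comap_le_sup_of_forall_mem_algebraicClasses_of_verdier hGT hf
    (fun _ W hW ↦ forall_mem_algebraicClasses_of_hcAtDim h hf W hW) p t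

/-- **The algebraic fixed part in LATTICE form from `HC` of the fibres, granted Verdier**:
`(j_s^*)⁻¹ N^p(𝒳_s) = N^p(𝒳) ⊔ ker j_s^*` at every fibre (part XIX-c's `comap_eq_sup_of_hcAtDim` re-keyed; `≥` is part
XVII-b's unconditional `algebraicClasses_sup_ker_le_comap`). [cite: Milne2020HodgeClassesAV, Prop. 1 (p. 8)]
[cite: Verdier1976, Cor. (5.1)] -/
theorem comap_eq_sup_of_hcAtDim_of_verdier (hGT : Verdier1976_genericLocalTriviality) {d : ℕ} (h : HCAtDim d)
    {f : 𝒳 ⟶ S} (hf : IsCompactAbelianPencil f d) (p : ℕ) (s : ComplexPoints S) :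
    (algebraicClasses (fiberOver f s) p).comap (complexBetti.map (fiberι f s) (2 * p)).hom =
      algebraicClasses 𝒳 p ⊔ LinearMap.ker (complexBetti.map (fiberι f s) (2 * p)).hom :=
  le_antisymm (comap_le_sup_of_hcAtDim_of_verdier hGT h hf p s) (algebraicClasses_sup_ker_le_comap hf p s)

/-- **GRADED HOM ≡ NUM, granted Verdier: `HCAtDim d ⟹ (Num_t)(p,q)` for all `p + q = d`, at EVERY point of every
compact pencil of abelian `d`-folds** (part XIX-b's `numerical_of_hcAtDim` re-keyed).
[cite: Kleiman1968AlgebraicCycles, §3 (D(X))] [cite: CharlesSchnell2014Notes, Cor. 11.3.6 (p. 494)] -/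
theorem numerical_of_hcAtDim_of_verdier (hGT : Verdier1976_genericLocalTriviality) {d : ℕ} (h : HCAtDim d)
    {f : 𝒳 ⟶ S} (hf : IsCompactAbelianPencil f d) (t : ComplexPoints S) {p q : ℕ} (hpq : p + q = d) :
    ∀ b ∈ algebraicClasses (fiberOver f t) q,
      (∀ a ∈ algebraicClasses 𝒳 p,
        cupProduct (show 2 * p + 2 * (q + 1) = 2 * (d + 1) by omega) a (fiberGysin hf t q b) = 0) →
        fiberGysin hf t q b = 0 := by
  obtain ⟨B, hBdim, ⟨eB⟩⟩ := Andre1996.compactPencil_exists_abelianVariety_fiber_dim hf t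
  have hB : IsSmoothProjective B.dim B.X := AbelianVariety.isSmoothProjective_holds
  have hHCB := (hodgeConjectureFor_iff_of_isSmoothProjective nonempty_hodgeModel_holds hB).1 (h B hBdim)
  have hp : ∀ c : complexBetti (fiberOver f t) (2 * p), IsRationalClass c →
      IsOfHodgeType d (fiberOver f t) (2 * p) p p c → c ∈ algebraicClasses (fiberOver f t) p := by
    have h' := hHCB p
    rw [hBdim] at h'
    exact (forall_hodgeClass_mem_algebraicClasses_iff_of_iso eB p).1 h'
  exact numerical_of_comap_le_sup_of_hodge hf t hpq hp (comap_le_sup_of_hcAtDim_of_verdier hGT h hf p t)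

/-- **`d = 4`, granted Verdier, Moonen–Zarhin 1999 Thm. 0.1 and Markman 2025: the lattice identity AND (Num_t) in every
bidegree at every point of every compact pencil of abelian FOURFOLDS** — part XVIII-i's "smallest open instance
`(2,2)`" holds modulo these inputs (one an arXiv claim) and Verdier. [cite: MoonenZarhin1999LowDim, Thm. 0.1]
[cite: Markman2025SecantWeil, Cor. 1.6.1] [cite: Kleiman1968AlgebraicCycles, §3 (D(X))] -/
theorem comap_eq_sup_and_numerical_of_relDim_four_of_verdier (hGT : Verdier1976_genericLocalTriviality)
    (h01 : MoonenZarhin1999_codimTwoHodgeClasses_abelianFourfold)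
    (hM : Markman2025_weilClasses_algebraic_abelianFourfold) {f : 𝒳 ⟶ S} (hf : IsCompactAbelianPencil f 4)
    (t : ComplexPoints S) :
    (∀ p : ℕ, (algebraicClasses (fiberOver f t) p).comap (complexBetti.map (fiberι f t) (2 * p)).hom =
      algebraicClasses 𝒳 p ⊔ LinearMap.ker (complexBetti.map (fiberι f t) (2 * p)).hom) ∧
    ∀ {p q : ℕ} (hpq : p + q = 4), ∀ b ∈ algebraicClasses (fiberOver f t) q,
      (∀ a ∈ algebraicClasses 𝒳 p,
        cupProduct (show 2 * p + 2 * (q + 1) = 2 * (4 + 1) by omega) a (fiberGysin hf t q b) = 0) →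
        fiberGysin hf t q b = 0 :=
  ⟨fun p ↦ comap_eq_sup_of_hcAtDim_of_verdier hGT (hcAtDim_four_of_weilClassesFourfolds h01 hM) hf p t,
    fun hpq ↦ numerical_of_hcAtDim_of_verdier hGT (hcAtDim_four_of_weilClassesFourfolds h01 hM) hf t hpq⟩

/-- **`d = 5`, granted Verdier, Moonen–Zarhin 1999 Thms. 0.1–0.2 and Markman 2025: the lattice identity AND (Num_t) in
every bidegree at every point of every compact pencil of abelian FIVEFOLDS.** [cite: MoonenZarhin1999LowDim, Thm. 0.2]
[cite: Markman2025SecantWeil, Cor. 1.6.1] [cite: Kleiman1968AlgebraicCycles, §3 (D(X))] -/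
theorem comap_eq_sup_and_numerical_of_relDim_five_of_verdier (hGT : Verdier1976_genericLocalTriviality)
    (h01 : MoonenZarhin1999_codimTwoHodgeClasses_abelianFourfold)
    (h02 : MoonenZarhin1999_codimTwoHodgeClasses_abelianFivefold)
    (hM : Markman2025_weilClasses_algebraic_abelianFourfold) {f : 𝒳 ⟶ S} (hf : IsCompactAbelianPencil f 5)
    (t : ComplexPoints S) :
    (∀ p : ℕ, (algebraicClasses (fiberOver f t) p).comap (complexBetti.map (fiberι f t) (2 * p)).hom =
      algebraicClasses 𝒳 p ⊔ LinearMap.ker (complexBetti.map (fiberι f t) (2 * p)).hom) ∧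
    ∀ {p q : ℕ} (hpq : p + q = 5), ∀ b ∈ algebraicClasses (fiberOver f t) q,
      (∀ a ∈ algebraicClasses 𝒳 p,
        cupProduct (show 2 * p + 2 * (q + 1) = 2 * (5 + 1) by omega) a (fiberGysin hf t q b) = 0) →
        fiberGysin hf t q b = 0 :=
  ⟨fun p ↦ comap_eq_sup_of_hcAtDim_of_verdier hGT
      (hcAtDim_five_of_hcAtDim_four h02 (hcAtDim_four_of_weilClassesFourfolds h01 hM)) hf p t,
    fun hpq ↦ numerical_of_hcAtDim_of_verdier hGT
      (hcAtDim_five_of_hcAtDim_four h02 (hcAtDim_four_of_weilClassesFourfolds h01 hM)) hf t hpq⟩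

/-! ## §3 Pencil by pencil at a CM point, granted `HC_CM` and Verdier -/

/-- **At a CM point `t`, granted `HC_CM` and Verdier: the lift at `t` in every codimension ⟺ (IHC_f)** (part XIX-e's
`comap_le_sup_iff_forall_mem_algebraicClasses_of_HC_CM` re-keyed). `HC_CM` a BINDER.
[cite: Milne2020HodgeClassesAV, Prop. 1 (p. 7)] [cite: Verdier1976, Cor. (5.1)] -/
theorem comap_le_sup_iff_forall_mem_algebraicClasses_of_HC_CM_of_verdier (hCM : RankFourFaces.CMAbelianHodge)
    (hGT : Verdier1976_genericLocalTriviality) {d : ℕ} {f : 𝒳 ⟶ S} (hf : IsCompactAbelianPencil f d)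
    {t : ComplexPoints S} (ht : t ∈ cmLocus f d) :
    (∀ p : ℕ, (algebraicClasses (fiberOver f t) p).comap (complexBetti.map (fiberι f t) (2 * p)).hom ≤
      algebraicClasses 𝒳 p ⊔ LinearMap.ker (complexBetti.map (fiberι f t) (2 * p)).hom) ↔
      ∀ (p : ℕ) (W : complexBetti 𝒳 (2 * p)),
        (∀ s : ComplexPoints S, IsRationalClass (complexBetti.map (fiberι f s) (2 * p) W) ∧
          IsOfHodgeType d (fiberOver f s) (2 * p) p p (complexBetti.map (fiberι f s) (2 * p) W)) →
        ∀ s : ComplexPoints S, complexBetti.map (fiberι f s) (2 * p) W ∈ algebraicClasses (fiberOver f s) p :=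
  ⟨fun hL p W hW s ↦ forall_mem_algebraicClasses_of_comap_le_sup_of_HC_CM hCM hf ht hL p W hW s,
    fun h p ↦ comap_le_sup_of_forall_mem_algebraicClasses_of_verdier hGT hf h p t⟩

/-- **At a CM point `t`, granted `HC_CM` and Verdier: CONJECTURE D FOR THE CM-FIBRE-SUPPORTED CYCLES OF THE TOTAL SPACE
⟺ ABDULALI'S TRANSPORT ON THIS PENCIL** (part XIX-e's `numerical_iff_invariantCyclesHoldFor_of_HC_CM` re-keyed).
`HC_CM` a BINDER. [cite: Kleiman1968AlgebraicCycles, §3 (D(X))] [cite: Abdulali1994FamiliesAV, (1.1) (p. 1122)]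
[cite: Verdier1976, Cor. (5.1)] -/
theorem numerical_iff_invariantCyclesHoldFor_of_HC_CM_of_verdier (hCM : RankFourFaces.CMAbelianHodge)
    (hGT : Verdier1976_genericLocalTriviality) {d : ℕ} {f : 𝒳 ⟶ S} (hf : IsCompactAbelianPencil f d)
    {t : ComplexPoints S} (ht : t ∈ cmLocus f d) :
    (∀ (p q : ℕ) (hpq : p + q = d), ∀ b ∈ algebraicClasses (fiberOver f t) q,
      (∀ a ∈ algebraicClasses 𝒳 p,
        cupProduct (show 2 * p + 2 * (q + 1) = 2 * (d + 1) by omega) a (fiberGysin hf t q b) = 0) →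
        fiberGysin hf t q b = 0) ↔
      InvariantCyclesHoldFor f d := by
  rw [invariantCyclesHoldFor_iff_forall_mem_algebraicClasses_of_HC_CM hCM ht,
    ← comap_le_sup_iff_forall_mem_algebraicClasses_of_HC_CM_of_verdier hCM hGT hf ht]
  refine ⟨fun h p ↦ ?_, fun h p q hpq ↦ (numerical_iff_comap_le_sup_of_HC_CM hCM hf ht hpq).2 (h p)⟩
  rcases le_or_gt p d with hp | hp
  · exact (numerical_iff_comap_le_sup_of_HC_CM hCM hf ht (show p + (d - p) = d by omega)).1 (h p (d - p) (by omega))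
  · haveI := subsingleton_complexBetti (hf.isSmoothProjective_fiberOver t) (show 2 * d < 2 * p by omega)
    intro W _
    refine Submodule.mem_sup_right ?_
    rw [LinearMap.mem_ker]
    exact Subsingleton.elim _ _

/-- **The find-the-cycle form, pencil by pencil, granted `HC_CM` and Verdier** (part XIX-e's
`detect_iff_forall_mem_algebraicClasses_of_HC_CM` re-keyed): at a CM point, [every algebraic `b` on the CM fibre with
`j_{t*} b ≠ 0` is detected by an algebraic class of the total space] ⟺ (IHC_f).
[cite: Kleiman1968AlgebraicCycles, §3 (D(X))] [cite: Andre1996Motifs, §6.3 Remarque 2 (p. 33)] -/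
theorem detect_iff_forall_mem_algebraicClasses_of_HC_CM_of_verdier (hCM : RankFourFaces.CMAbelianHodge)
    (hGT : Verdier1976_genericLocalTriviality) {d : ℕ} {f : 𝒳 ⟶ S} (hf : IsCompactAbelianPencil f d)
    {t : ComplexPoints S} (ht : t ∈ cmLocus f d) :
    (∀ (p q : ℕ) (hpq : p + q = d), ∀ b ∈ algebraicClasses (fiberOver f t) q, fiberGysin hf t q b ≠ 0 →
      ∃ a ∈ algebraicClasses 𝒳 p,
        cupProduct (show 2 * p + 2 * q = 2 * d by omega) (complexBetti.map (fiberι f t) (2 * p) a) b ≠ 0) ↔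
      ∀ (p : ℕ) (W : complexBetti 𝒳 (2 * p)),
        (∀ s : ComplexPoints S, IsRationalClass (complexBetti.map (fiberι f s) (2 * p) W) ∧
          IsOfHodgeType d (fiberOver f s) (2 * p) p p (complexBetti.map (fiberι f s) (2 * p) W)) →
        ∀ s : ComplexPoints S, complexBetti.map (fiberι f s) (2 * p) W ∈ algebraicClasses (fiberOver f s) p := by
  rw [← invariantCyclesHoldFor_iff_forall_mem_algebraicClasses_of_HC_CM hCM ht,
    ← numerical_iff_invariantCyclesHoldFor_of_HC_CM_of_verdier hCM hGT hf ht]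
  exact forall₃_congr fun p q hpq ↦ (numerical_iff_detect hf t hpq).symm

/-! ## §4 `E`-power points, no `HC_CM`, granted Verdier -/

/-- **`HCAtDim d ∧ Verdier ⟹ NumE[d, p, q]`** (part XIX-f's row re-keyed). [cite: Kleiman1968AlgebraicCycles, §3 (D(X))] -/
theorem numericalE_of_hcAtDim_of_verdier (hGT : Verdier1976_genericLocalTriviality) {d : ℕ} (h : HCAtDim d)
    (p q : ℕ) : NumE[d, p, q] :=
  fun _ _ _ hf t _ hpq ↦ numerical_of_hcAtDim_of_verdier hGT h hf t hpq

/-- **Part IX's transport input implies the `E`-power bracket, granted Verdier**: `CMAnchoredTransportAtRelDim d ⟹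
NumE[d, p, q]` (part XIX-f's `numericalE_of_cmAnchoredTransportAtRelDim` re-keyed).
[cite: Andre1996Motifs, §6.3 a) (p. 33)] [cite: Verdier1976, Cor. (5.1)] -/
theorem numericalE_of_cmAnchoredTransportAtRelDim_of_verdier (hGT : Verdier1976_genericLocalTriviality) {d : ℕ}
    (hT : CMAnchoredTransportAtRelDim d) (p q : ℕ) : NumE[d, p, q] := by
  intro 𝒳 S f hf t ht hpq
  have hHC := hodgeConjectureFor_fiberOver_of_mem_cmPowerLocus ht
  have htcm := mem_cmLocus_of_mem_cmPowerLocus ht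
  have hIHC : ∀ (p' : ℕ) (W : complexBetti 𝒳 (2 * p')),
      (∀ s : ComplexPoints S, IsRationalClass (complexBetti.map (fiberι f s) (2 * p') W) ∧
        IsOfHodgeType d (fiberOver f s) (2 * p') p' p' (complexBetti.map (fiberι f s) (2 * p') W)) →
      ∀ s : ComplexPoints S, complexBetti.map (fiberι f s) (2 * p') W ∈ algebraicClasses (fiberOver f s) p' :=
    fun p' W hW s ↦ hT f hf p' W hW t htcm (hHC.2 p' _ (hW t).1 (hW t).2) s
  have hL := comap_le_sup_of_forall_mem_algebraicClasses_of_verdier hGT hf hIHC p t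
  exact numerical_of_comap_le_sup_of_hodge hf t hpq (fun c hc hcp ↦ hHC.2 p c hc hcp) hL

/-- **PENCIL BY PENCIL AT AN `E`-POWER POINT, NO `HC_CM`, granted Verdier: conjecture D for the cycles of the total space
supported on the `E`-power fibre, in every bidegree, ⟺ Abdulali's (1.1)_f on this pencil** (part XIX-f's
`numerical_iff_invariantCyclesHoldFor_of_mem_cmPowerLocus` re-keyed; ⟹ needs nothing).
[cite: Kleiman1968AlgebraicCycles, §3 (D(X))] [cite: Abdulali1994FamiliesAV, (1.1) (p. 1122)]
[cite: vanGeemen1994HodgeAV, Thm. 4.3] [cite: Verdier1976, Cor. (5.1)] -/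
theorem numerical_iff_invariantCyclesHoldFor_of_mem_cmPowerLocus_of_verdier
    (hGT : Verdier1976_genericLocalTriviality) {d : ℕ} {f : 𝒳 ⟶ S} (hf : IsCompactAbelianPencil f d)
    {t : ComplexPoints S} (ht : t ∈ cmPowerLocus f d) :
    (∀ (p q : ℕ) (hpq : p + q = d), ∀ b ∈ algebraicClasses (fiberOver f t) q,
      (∀ a ∈ algebraicClasses 𝒳 p,
        cupProduct (two_mul_add_two_mul_succ_eq hpq) a (fiberGysin hf t q b) = 0) →
        fiberGysin hf t q b = 0) ↔
      InvariantCyclesHoldFor f d := by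
  have hHC := hodgeConjectureFor_fiberOver_of_mem_cmPowerLocus ht
  constructor
  · intro h
    have hL : ∀ p : ℕ, (algebraicClasses (fiberOver f t) p).comap (complexBetti.map (fiberι f t) (2 * p)).hom ≤
        algebraicClasses 𝒳 p ⊔ LinearMap.ker (complexBetti.map (fiberι f t) (2 * p)).hom := by
      intro p
      rcases le_or_gt p d with hp | hp
      · exact comap_le_sup_of_numerical_of_mem_cmPowerLocus hf ht (show p + (d - p) = d by omega)
          (h p (d - p) (by omega))
      · haveI := subsingleton_complexBetti (hf.isSmoothProjective_fiberOver t) (show 2 * d < 2 * p by omega)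
        intro W _
        refine Submodule.mem_sup_right ?_
        rw [LinearMap.mem_ker]
        exact Subsingleton.elim _ _
    exact invariantCyclesHoldFor_of_forall_mem_algebraicClasses fun p W hW s ↦
      forall_mem_algebraicClasses_of_comap_le_sup_of_mem_cmPowerLocus hf ht hL p W hW s
  · intro hT p q hpq
    have hIHC : ∀ (p' : ℕ) (W : complexBetti 𝒳 (2 * p')),
        (∀ s : ComplexPoints S, IsRationalClass (complexBetti.map (fiberι f s) (2 * p') W) ∧
          IsOfHodgeType d (fiberOver f s) (2 * p') p' p' (complexBetti.map (fiberι f s) (2 * p') W)) →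
        ∀ s : ComplexPoints S, complexBetti.map (fiberι f s) (2 * p') W ∈ algebraicClasses (fiberOver f s) p' :=
      fun p' W hW s ↦ hT p' W hW ⟨t, hHC.2 p' _ (hW t).1 (hW t).2⟩ s
    exact numerical_of_comap_le_sup_of_hodge hf t hpq (fun c hc hcp ↦ hHC.2 p c hc hcp)
      (comap_le_sup_of_forall_mem_algebraicClasses_of_verdier hGT hf hIHC p t)

/-! ## §5 Under `HC_CM`: Num^CM ⟺ (4) without Lemme 6.3.1; and `F_CM ⟺ Num^CM` (REFEREE-AB F-ab-90) -/

/-- **`HC_CM ⊢ Num^CM ⟺ (4)`, granted Verdier** (Num^CM ⟺ (L) by part XVIII-c; (L) ⟺ (4) by part XX-a). No `h₂₁`.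
`HC_CM` a BINDER. [cite: Kleiman1968AlgebraicCycles, §3 (D(X))] [cite: Andre1996Motifs, §6.3 a) (p. 33)] -/
theorem cmPointedPencilNumerical_iff_cmAnchoredTransport_of_HC_CM_of_verdier (hCM : RankFourFaces.CMAbelianHodge)
    (hGT : Verdier1976_genericLocalTriviality) : CMPointedPencilNumerical ↔ CMAnchoredTransport := by
  rw [← cmFibreAlgebraicLift_iff_cmPointedPencilNumerical_of_HC_CM hCM]
  exact cmFibreAlgebraicLift_iff_cmAnchoredTransport_of_verdier hGT

/-- **REFEREE-AB F-ab-90: granted `HC_CM`, Lemme 6.3.1 and Verdier, `F_CM ⟺ Num^CM`** — the sub-cell's least kernel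
candidate `HodgeFailureSpreadsToCMFibre` (ab-spread-1, part VII) and the numerical node agree under `HC_CM`: both are
then equivalent to `HC_AV` (`hodgeFailureSpreadsToCMFibre_iff_HC_AV_of_HC_CM`, fact-free; part XX-a's
`HC_AV_iff_HC_CM_and_cmPointedPencilNumerical_of_verdier`). Fact-free, and modulo Lieberman + Lemme 6.3.1 alone, only
`Num^CM ⟹ F_CM` is in the kernel (part XII); nothing is thereby minimal. `HC_CM`, `h₂₁` BINDERS. research route, not a
corollary; conditional on HC_CM plus one named minimal statement. [cite: Andre1996Motifs, Lemme 6.3.1 (p. 31)]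
[cite: Kleiman1968AlgebraicCycles, §3 (D(X))] [cite: Verdier1976, Cor. (5.1)] -/
theorem hodgeFailureSpreadsToCMFibre_iff_cmPointedPencilNumerical_of_HC_CM_of_verdier
    (hCM : RankFourFaces.CMAbelianHodge) (h₂₁ : andre1996_cmAnchoredPencil)
    (hGT : Verdier1976_genericLocalTriviality) : HodgeFailureSpreadsToCMFibre ↔ CMPointedPencilNumerical := by
  rw [hodgeFailureSpreadsToCMFibre_iff_HC_AV_of_HC_CM hCM]
  exact ⟨cmPointedPencilNumerical_of_HC_AV_of_verdier hGT,
    fun h ↦ HC_AV_of_HC_CM_of_cmPointedPencilNumerical h₂₁ hCM h⟩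

/-- **F-ab-90, the half that needs no `h₂₁`: `HC_CM ∧ F_CM ⟹ Num^CM`, granted Verdier.** [cite: Verdier1976, Cor. (5.1)] -/
theorem cmPointedPencilNumerical_of_HC_CM_of_hodgeFailureSpreadsToCMFibre_of_verdier
    (hCM : RankFourFaces.CMAbelianHodge) (hGT : Verdier1976_genericLocalTriviality)
    (hF : HodgeFailureSpreadsToCMFibre) : CMPointedPencilNumerical :=
  cmPointedPencilNumerical_of_HC_AV_of_verdier hGT ((hodgeFailureSpreadsToCMFibre_iff_HC_AV_of_HC_CM hCM).1 hF)

end Summit.HodgeConjecture.HodgeConjecture.Ring2.AbelianAll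

end
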